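import Literature.NumberTheory.EllipticCurves.PadicSigmaVariableChangeProofs
import Literature.NumberTheory.EllipticCurves.SigmaSqDivisionBridgeProofs
import Literature.NumberTheory.EllipticCurves.FormalInvXExpansionProofs
import Literature.NumberTheory.EllipticCurves.PadicSigmaSqTwoMazurTateExistenceHolds
import Literature.NumberTheory.EllipticCurves.FormalGroupDictionaryProofs
import HarnessLib

/-!
# The sigma-squared pair of a TWISTED model: transport of `Σ = 𝔖(1/x)` along a change of variables
# defined over an extension of `ℚ_p` (proofs only)

Topic `Literature/NumberTheory/EllipticCurves` (trunk T-NT-EC). Pure proof file (no definition, no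
named fact), sequel of `PadicSigmaSqVariableChangeProofs.lean` (transport of sigma-squared pairs along
`ℤ_p`-integral changes of variables OVER `ℚ_p`) and of `FormalInvXExpansionProofs.lean` (the
`x⁻¹`-expansion `Σ = 𝔖(1/x)` of an even series). Width seat `bsd-line-cf2-p1-w5` (g20) of the cell
`bsd-print-cf2`, in support of stmt-BirchSwinnertonDyer-20368 (road (C) `disegni-pair-two`, the pinning
stub `stub_pin_minusTwist_two` of the planner's re-cut: a canonical `2`-adic height datum on the
ADDITIVE quadratic twists `V^{(d)}`, `d ∈ {−1, ±2}`, of a curve `V` good ordinary at `2`). BSD is not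
proved by any of this.

## The point

A quadratic twist `W = V^{(d)}` is isomorphic to `V` only over `ℚ_p(√d)`, by a change of variables
`vc = (u, 0, s, t)` with `u² = D ∈ ℚ_p` (`u = 2√d`, `D = 4d` on the integral twist model). Mazur–Tate
functoriality `σ_W = u⁻¹·σ_V ∘ θ` (the tree's `SatisfiesSigmaODE.variableChange_subst`, any `ℚ`-algebra)
therefore produces a sigma function of `W` with coefficients in `u⁻¹·ℚ_p⟦z⟧` — NOT over `ℚ_p` — but its
SQUARE is `ℚ_p`-rational: with `Σ_V = 𝔖(1/x_V)` and `1/x_V ∘ θ = u²/x_W` one gets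
`σ_W² = D⁻¹·𝔖(D/x_W) ∈ z² + z³ℤ_p⟦z⟧`. This file proves that `(D⁻¹·𝔖(D/x_W), D·c)` IS a sigma-squared
pair of `W` (`IsMazurTateSigmaSqPair`: normalised, integral, even, sigma-squared equation), so that the
tree's squared theta relation `IsMazurTateSigmaSqPair.thetaSq_formal` — and with it the parallelogram
law of the sigma-squared height — becomes available on the twist, which has ADDITIVE reduction at `p`
(no Mazur–Tate pair of its own in the ordinary sense, and no uniqueness: `padicSigmaSq (W)` is not
pinned; consumers must carry THIS pair explicitly).

* §1 `map_formalInvX`, `formalInvX_mul_formalXMulSq`, `formalInvX_variableChange_subst`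
  (**`1/x'(θ(z)) = u²/x(z)`** for `r = 0`, any ring), `subst_formalInvX_rescale`;
* §2 the rescaled expansion `λ⁻¹·S(λ/x)`: normalisation (`constantCoeff_…`, `coeff_one_…`,
  `coeff_two_rescale_subst_formalInvX`), evenness (`isFormallyEven_rescale_subst_formalInvX`), and
  `IsInvXExpansion.constantCoeff_eq` / `.coeff_one_eq`;
* §3 `map_sigmaSqG`, `satisfiesSigmaSqODE_map_iff` — the sigma-squared equation commutes with base
  change and is REFLECTED along an injective one;
* §4 `isPadicInt_formalInvX`, `IsInvXExpansion.isPadicInt` (**the `x⁻¹`-expansion of an integral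
  series is integral**), `isPadicInt_rescale_subst_formalInvX`;
* §5 `isMazurTateSigmaSqPair_twistTransport` — the theorem.

## Sources

* B. Mazur, J. Tate, *The `p`-adic sigma function*, Duke Math. J. 62 (1991): §3 (dependence of
  `σ_{(E,ω)}` on the model), Thm. 3.1. [MazurTate1991]
* B. Mazur, W. Stein, J. Tate, Doc. Math. Extra Vol. Coates (2006), Thm. 1.3 and §1 (`c` has
  weight `2`). [MazurSteinTate2006]
* J. H. Silverman, Math. Ann. 332 (2005), §5 Rem. 2 (`σ²` is the well-defined object at `p = 2`).
  [Silverman2005DivPoly]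
* J. H. Silverman, *The Arithmetic of Elliptic Curves*, 2nd ed. (2009), III.1 Table 3.1, IV.1.
  [SilvermanAEC2009]

## Design notes

Everything algebraic is over an arbitrary commutative ring / `ℚ`-algebra; `ℚ_p` enters only for
integrality and in §5, where `K` is any field of characteristic `0` with an `ℚ_p`-algebra structure
(consumers take `K = AlgebraicClosure ℚ_[2]` to host `√d`). No definition, no named fact, no `sorry`.
-/

noncomputable section

open PowerSeries Literature.NumberTheory.EllipticCurves

namespace WeierstrassCurve

/-! ### §1 `1/x(z)` under base change and under a change of variables with `r = 0` -/

section Ring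

variable {R : Type*} [CommRing R] (W : WeierstrassCurve R) (vc : VariableChange R)

/-- `1/x(z)` commutes with base change (`w/z³ ∈ ℤ[a₁,…,a₆]⟦z⟧` does).
[cite: SilvermanAEC2009, IV.1.1] -/
theorem map_formalInvX {S : Type*} [CommRing S] (φ : R →+* S) :
    PowerSeries.map φ W.formalInvX = (W.map φ).formalInvX := by
  rw [formalInvX, formalInvX, map_mul, map_pow, PowerSeries.map_X, map_formalWDivCube]

/-- `(1/x)·(z²x) = z²`. [cite: SilvermanAEC2009, IV.1.1] -/
theorem formalInvX_mul_formalXMulSq : W.formalInvX * W.formalXMulSq = X ^ 2 := by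
  rw [formalInvX, mul_assoc, W.formalWDivCube_mul_formalXMulSq, mul_one]

/-- **`1/x'(θ(z)) = u²·(1/x(z))` for a change of variables `vc = (u, 0, s, t)`** (`x' = u⁻²x`,
read through the isomorphism `θ` of formal groups): the `x⁻¹`-parameter is multiplied by the
constant `u²`. [Silverman AEC III.1 Table 3.1 (`x = u²x' + r`), IV.1] [cite: SilvermanAEC2009, IV.1.1] -/
theorem formalInvX_variableChange_subst (hr : vc.r = 0) :
    (vc • W).formalInvX.subst (W.formalVariableChange vc) = C ((vc.u : R) ^ 2) * W.formalInvX := by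
  have hθs := W.hasSubst_formalVariableChange vc
  have hθ0 := W.constantCoeff_formalVariableChange vc
  set θ := W.formalVariableChange vc with hθdef
  -- `X'(θ)·z² = u⁻²θ²·X` (r = 0)
  have hX := W.formalXMulSq_variableChange_subst_mul_X_sq vc
  rw [hr, map_zero, zero_mul, sub_zero] at hX
  -- `X'(θ)` is a unit (constant term 1)
  have hT1 : constantCoeff ((vc • W).formalXMulSq.subst θ) = 1 := by
    rw [Literature.RingTheory.FormalGroups.constantCoeff_subst_of_constantCoeff_eq_zero hθ0,
      constantCoeff_formalXMulSq]
  have hTu : IsUnit ((vc • W).formalXMulSq.subst θ) := by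
    rw [PowerSeries.isUnit_iff_constantCoeff, hT1]; exact isUnit_one
  -- `(1/x')(θ)·X'(θ) = θ²`
  have h1 : (vc • W).formalInvX.subst θ * (vc • W).formalXMulSq.subst θ = θ ^ 2 := by
    rw [← subst_mul hθs, formalInvX_mul_formalXMulSq, subst_pow hθs, PowerSeries.subst_X hθs]
  -- `u²·(1/x)·X'(θ) = θ²` as well
  have hu : (C ((vc.u : R) ^ 2) : R⟦X⟧) * C ((vc.u⁻¹ : Rˣ) : R) ^ 2 = 1 := by
    rw [← map_pow, ← map_mul, ← mul_pow, Units.mul_inv, one_pow, map_one]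
  have h2 : C ((vc.u : R) ^ 2) * W.formalInvX * (vc • W).formalXMulSq.subst θ = θ ^ 2 := by
    have key : X ^ 2 * (C ((vc.u : R) ^ 2) * W.formalInvX * (vc • W).formalXMulSq.subst θ) =
        X ^ 2 * θ ^ 2 :=
      calc X ^ 2 * (C ((vc.u : R) ^ 2) * W.formalInvX * (vc • W).formalXMulSq.subst θ)
          = C ((vc.u : R) ^ 2) * W.formalInvX * ((vc • W).formalXMulSq.subst θ * X ^ 2) := by ring
        _ = C ((vc.u : R) ^ 2) * W.formalInvX *
              (C ((vc.u⁻¹ : Rˣ) : R) ^ 2 * θ ^ 2 * W.formalXMulSq) := by rw [hX]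
        _ = (C ((vc.u : R) ^ 2) * C ((vc.u⁻¹ : Rˣ) : R) ^ 2) * θ ^ 2 *
              (W.formalInvX * W.formalXMulSq) := by ring
        _ = X ^ 2 * θ ^ 2 := by rw [hu, formalInvX_mul_formalXMulSq]; ring
    exact PowerSeries.X_pow_mul_cancel key
  exact hTu.mul_right_cancel (h1.trans h2.symm)

/-- **A rescaled series in `1/x` is again a series in `1/x`**: `(a·S(bX))(1/x) = a·S(b/x)`
(substitution is a ring map and `(bX)(1/x) = b/x`). [cite: SilvermanAEC2009, IV.1.1] -/
theorem subst_formalInvX_rescale (S : R⟦X⟧) (a b : R) :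
    (C a * S.subst (C b * X)).subst W.formalInvX = C a * S.subst (C b * W.formalInvX) := by
  have hw := W.hasSubst_formalInvX
  have hbX : HasSubst (C b * X : R⟦X⟧) := HasSubst.of_constantCoeff_zero' (by simp)
  rw [subst_mul hw, PowerSeries.subst_C, subst_comp_subst_apply hbX hw, subst_mul hw,
    PowerSeries.subst_C, PowerSeries.subst_X hw]
  rfl

/-! ### §2 The rescaled `x⁻¹`-expansion `λ⁻¹·S(λ/x)` -/

variable {W} in
/-- An `x⁻¹`-expansion `S` of a series `Σ` with `Σ(0) = 0` has `S(0) = 0`. [cite: Silverman2005DivPoly, §5 Rem. 2] -/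
theorem IsInvXExpansion.constantCoeff_eq {Sq S : R⟦X⟧} (h : W.IsInvXExpansion Sq S)
    (h0 : constantCoeff Sq = 0) : constantCoeff S = 0 := by
  have e := W.coeff_two_mul_subst_formalInvX S 0
  rw [Finset.sum_range_zero, add_zero, mul_zero, coeff_zero_eq_constantCoeff] at e
  have hS : S.subst W.formalInvX = Sq := h
  rw [hS, h0] at e
  exact e.symm

variable {W} in
/-- An `x⁻¹`-expansion `S` of `Σ = z² + ⋯` has `S = w + O(w²)`. [cite: Silverman2005DivPoly, §5 Rem. 2] -/
theorem IsInvXExpansion.coeff_one_eq {Sq S : R⟦X⟧} (h : W.IsInvXExpansion Sq S)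
    (h0 : constantCoeff Sq = 0) (h2 : coeff 2 Sq = 1) : coeff 1 S = 1 := by
  have e := W.coeff_two_mul_subst_formalInvX S 1
  rw [Finset.sum_range_one, pow_zero, coeff_zero_eq_constantCoeff, h.constantCoeff_eq h0, zero_mul,
    add_zero, mul_one] at e
  have hS : S.subst W.formalInvX = Sq := h
  rw [hS, h2] at e
  exact e.symm

/-- **`λ⁻¹·S(λ/x) = (1/x)·S₁(λ/x)`** for `S = X·S₁` (`S(0) = 0`) and `λ⁻¹λ = 1`: the rescaled
expansion with the unit factored out. [cite: SilvermanAEC2009, IV.1.1] [cite: Silverman2005DivPoly, §5 Rem. 2] -/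
theorem rescale_subst_formalInvX_eq (S : R⟦X⟧) (hS0 : constantCoeff S = 0) {a b : R} (hab : a * b = 1) :
    C a * S.subst (C b * W.formalInvX) =
      W.formalInvX * (sigmaShift S).subst (C b * W.formalInvX) := by
  have hg : HasSubst (C b * W.formalInvX) :=
    HasSubst.of_constantCoeff_zero' (by rw [map_mul, constantCoeff_formalInvX, mul_zero])
  conv_lhs => rw [← X_mul_sigmaShift hS0]
  rw [subst_mul hg, PowerSeries.subst_X hg, ← mul_assoc, ← mul_assoc, ← map_mul, hab, map_one, one_mul]

/-- `λ⁻¹·S(λ/x)` has zero constant term (`S(0) = 0`, `λ⁻¹λ = 1`). [cite: Silverman2005DivPoly, §5 Rem. 2] -/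
theorem constantCoeff_rescale_subst_formalInvX (S : R⟦X⟧) (hS0 : constantCoeff S = 0) {a b : R}
    (hab : a * b = 1) : constantCoeff (C a * S.subst (C b * W.formalInvX)) = 0 := by
  rw [W.rescale_subst_formalInvX_eq S hS0 hab, map_mul, constantCoeff_formalInvX, zero_mul]

/-- `[z¹](λ⁻¹·S(λ/x)) = 0`. [cite: Silverman2005DivPoly, §5 Rem. 2] -/
theorem coeff_one_rescale_subst_formalInvX (S : R⟦X⟧) (hS0 : constantCoeff S = 0) {a b : R}
    (hab : a * b = 1) : coeff 1 (C a * S.subst (C b * W.formalInvX)) = 0 := by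
  rw [W.rescale_subst_formalInvX_eq S hS0 hab, coeff_one_mul_eq, coeff_zero_eq_constantCoeff_apply,
    constantCoeff_formalInvX, coeff_one_formalInvX, zero_mul, zero_mul, add_zero]

/-- `[z²](λ⁻¹·S(λ/x)) = 1` for `S = w + O(w²)` (Silverman's normalisation `σ² ∈ z² + z³R⟦z⟧`). [cite: Silverman2005DivPoly, §5 Rem. 2] -/
theorem coeff_two_rescale_subst_formalInvX (S : R⟦X⟧) (hS0 : constantCoeff S = 0)
    (hS1 : coeff 1 S = 1) {a b : R} (hab : a * b = 1) :
    coeff 2 (C a * S.subst (C b * W.formalInvX)) = 1 := by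
  have hg0 : constantCoeff (C b * W.formalInvX) = 0 := by
    rw [map_mul, constantCoeff_formalInvX, mul_zero]
  have hU : constantCoeff ((sigmaShift S).subst (C b * W.formalInvX)) = 1 := by
    rw [Literature.RingTheory.FormalGroups.constantCoeff_subst_of_constantCoeff_eq_zero hg0,
      constantCoeff_sigmaShift, hS1]
  rw [W.rescale_subst_formalInvX_eq S hS0 hab, coeff_two_mul_eq, coeff_zero_eq_constantCoeff_apply,
    coeff_zero_eq_constantCoeff_apply, constantCoeff_formalInvX, coeff_one_formalInvX,
    coeff_two_formalInvX, hU]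
  ring

variable {W} in
/-- `λ⁻¹·S(λ/x)` IS a series in `1/x`, hence EVEN (`IsInvXExpansion.isFormallyEven`).
[cite: Silverman2005DivPoly, §5 Rem. 2] -/
theorem isFormallyEven_rescale_subst_formalInvX (S : R⟦X⟧) (a b : R) :
    W.IsFormallyEven (C a * S.subst (C b * W.formalInvX)) :=
  IsInvXExpansion.isFormallyEven (S := C a * S.subst (C b * X)) (W.subst_formalInvX_rescale S a b)

end Ring

/-! ### §3 Base change of the sigma-squared equation -/

section MapSq

variable {A B : Type*} [CommRing A] [CommRing B] [Algebra ℚ A] [Algebra ℚ B] (φ : A →+* B)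
  (W : WeierstrassCurve A)

omit [Algebra ℚ A] [Algebra ℚ B] in
/-- `sigmaShift` commutes with `map`. [folklore] -/
private theorem map_sigmaShift' (σ : A⟦X⟧) :
    PowerSeries.map φ (sigmaShift σ) = sigmaShift (PowerSeries.map φ σ) := by
  ext n; simp [coeff_sigmaShift, coeff_map]

omit [Algebra ℚ A] [Algebra ℚ B] in
/-- `d/dz` commutes with `map`. [folklore] -/
private theorem map_derivative' (f : A⟦X⟧) :
    PowerSeries.map φ (d⁄dX A f) = d⁄dX B (PowerSeries.map φ f) := by
  ext n; simp [coeff_map, coeff_derivative]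

/-- **`G_Σ` commutes with base change** (`Σ = z² + ⋯`). [cite: MazurSteinTate2006, Thm. 1.3] -/
theorem map_sigmaSqG {Sq : A⟦X⟧} (h2 : coeff 2 Sq = 1) :
    PowerSeries.map φ (W.sigmaSqG Sq) = (W.map φ).sigmaSqG (PowerSeries.map φ Sq) := by
  have hS : constantCoeff (W.formalOmega * sigmaShift (sigmaShift Sq)) = 1 := by
    rw [map_mul, W.constantCoeff_formalOmega, constantCoeff_sigmaShift, coeff_sigmaShift, h2, one_mul]
  rw [sigmaSqG, sigmaSqG, map_mul, Literature.NumberTheory.EllipticCurves.map_invOfUnit_one φ _ hS,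
    map_mul, map_formalOmega, map_add, map_mul, map_mul, map_derivative', map_sigmaShift',
    map_sigmaShift', PowerSeries.map_X, map_ofNat]

variable {W} in
/-- **The sigma-squared equation is preserved, and for an injective base change REFLECTED, by base
change**: `Σ` satisfies `2(x + c) = −D(DΣ/Σ)` on `W` iff `Σ^φ` does on `W^φ` with constant `φ(c)`
(`φ` injective, `Σ = z² + ⋯`). [cite: MazurSteinTate2006, Thm. 1.3] [cite: Silverman2005DivPoly, §5 Rem. 2] -/
theorem satisfiesSigmaSqODE_map_iff (hφ : Function.Injective φ) {Sq : A⟦X⟧} {c : A}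
    (h2 : coeff 2 Sq = 1) :
    (W.map φ).SatisfiesSigmaSqODE (PowerSeries.map φ Sq) (φ c) ↔ W.SatisfiesSigmaSqODE Sq c := by
  have hinj := PowerSeries.map_injective φ hφ
  unfold SatisfiesSigmaSqODE
  rw [← map_sigmaSqG φ W h2, ← map_derivative', ← PowerSeries.map_X (f := φ), ← map_mul, ← map_sub,
    ← map_formalOmega, ← map_formalXMulSq, ← PowerSeries.map_C (f := φ), ← map_pow, ← map_mul,
    ← map_add, ← map_mul]
  have h2' : (PowerSeries.map φ) (2 : A⟦X⟧) = 2 := map_ofNat _ 2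
  constructor
  · intro h
    apply hinj
    rw [map_mul, h2', h]
  · intro h
    rw [← h2', ← map_mul, h]

end MapSq

/-! ### §4 Integrality over `ℚ_p` -/

section Padic

variable {p : ℕ} [Fact p.Prime] (W : WeierstrassCurve ℚ_[p])

/-- `1/x(z) ∈ ℤ_p⟦z⟧` for a `p`-integral equation. [cite: SilvermanAEC2009, IV.1.1] -/
theorem isPadicInt_formalInvX [W.IsIntegral ℤ_[p]] : IsPadicInt W.formalInvX :=
  (IsPadicInt.powerSeries_X.pow 2).mul W.isPadicInt_formalWDivCube

variable {W} in
/-- **The `x⁻¹`-expansion of an integral series is integral**: if `Σ ∈ ℤ_p⟦z⟧` and `S(1/x) = Σ`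
(`p`-integral equation) then `S ∈ ℤ_p⟦w⟧` — the system `[z^{2n}]Σ = S_n + Σ_{k<n} S_k[z^{2n}](1/x)^k`
is unitriangular over `ℤ_p`. [cite: Silverman2005DivPoly, §5 Rem. 2] [cite: SilvermanAEC2009, IV.1.1] -/
theorem IsInvXExpansion.isPadicInt [W.IsIntegral ℤ_[p]] {Sq S : ℚ_[p]⟦X⟧} (h : W.IsInvXExpansion Sq S)
    (hSq : IsPadicInt Sq) : IsPadicInt S := by
  rw [isPadicInt_iff_coeff]
  have hw : ∀ k n, ‖coeff n (W.formalInvX ^ k)‖ ≤ 1 := fun k n =>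
    isPadicInt_iff_coeff.mp (W.isPadicInt_formalInvX.pow k) n
  have hSq' := isPadicInt_iff_coeff.mp hSq
  have hS : S.subst W.formalInvX = Sq := h
  intro n
  induction n using Nat.strong_induction_on with
  | _ n ih =>
    have e := W.coeff_two_mul_subst_formalInvX S n
    rw [hS] at e
    have e' : coeff n S = coeff (2 * n) Sq -
        ∑ k ∈ Finset.range n, coeff k S * coeff (2 * n) (W.formalInvX ^ k) := by
      rw [e]; ring
    rw [e', sub_eq_add_neg]
    refine (IsUltrametricDist.norm_add_le_max _ _).trans (max_le (hSq' _) ?_)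
    rw [norm_neg]
    refine IsUltrametricDist.norm_sum_le_of_forall_le_of_nonneg zero_le_one fun k hk => ?_
    rw [norm_mul]
    exact mul_le_one₀ (ih k (Finset.mem_range.mp hk)) (norm_nonneg _) (hw k _)

variable {W} in
/-- **`λ⁻¹·S(λ/x) ∈ ℤ_p⟦z⟧`** for `S ∈ ℤ_p⟦w⟧` with `S(0) = 0`, `λ ∈ ℤ_p`, `λ⁻¹λ = 1` and a
`p`-integral equation (it is `(1/x)·S₁(λ/x)`, `S = wS₁`; Silverman: `σ²` is defined over `ℤ_p`). [cite: Silverman2005DivPoly, §5 Rem. 2] -/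
theorem isPadicInt_rescale_subst_formalInvX [W.IsIntegral ℤ_[p]] {S : ℚ_[p]⟦X⟧} (hS : IsPadicInt S)
    (hS0 : constantCoeff S = 0) {a b : ℚ_[p]} (hab : a * b = 1) (hb : ‖b‖ ≤ 1) :
    IsPadicInt (C a * S.subst (C b * W.formalInvX)) := by
  have hg : HasSubst (C b * W.formalInvX) :=
    HasSubst.of_constantCoeff_zero' (by rw [map_mul, constantCoeff_formalInvX, mul_zero])
  have hgi : IsPadicInt (C b * W.formalInvX) := (IsPadicInt.C hb).mul W.isPadicInt_formalInvX
  have hS1 : IsPadicInt (sigmaShift S) := by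
    rw [isPadicInt_iff_coeff] at hS ⊢
    intro n; rw [coeff_sigmaShift]; exact hS _
  rw [W.rescale_subst_formalInvX_eq S hS0 hab]
  exact W.isPadicInt_formalInvX.mul (hS1.powerSeries_subst hgi hg)

end Padic

/-! ### §5 The transport theorem -/

section Transport

variable {p : ℕ} [Fact p.Prime] {K : Type*} [Field K] [CharZero K] [Algebra ℚ_[p] K]
  (V W : WeierstrassCurve ℚ_[p]) (vc : VariableChange K)

/-- **The sigma-squared pair of a twisted model.** Let `V/ℚ_p` be `p`-integral with a sigma-squared
pair `(Σ, c)` (`IsMazurTateSigmaSqPair`; e.g. the Mazur–Tate `σ²` at a good ordinary `p`, `p = 2`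
included) and let `𝔖` be the `x⁻¹`-expansion of `Σ` (`Σ = 𝔖(1/x)`, `IsInvXExpansion`). Let `W/ℚ_p` be
`p`-integral and isomorphic to `V` OVER AN EXTENSION `K ⊇ ℚ_p` by a change of variables
`vc = (u, 0, s, t)`, `vc • W_K = V_K`, whose `u² = D` lies in `ℤ_p` — the shape of a QUADRATIC TWIST
`W = V^{(d)}` read on an integral model (`u = 2√d`, `D = 4d`, `s, t` completing the square). Then
**`(D⁻¹·𝔖(D/x_W), D·c)` is a sigma-squared pair of `W`**: a normalised EVEN solution in `z² + z³ℤ_p⟦z⟧`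
of the sigma-squared equation of `W`, with `ℚ_p`-coefficients although the isomorphism is not defined
over `ℚ_p` — Mazur–Tate functoriality `σ_W = u⁻¹σ_V ∘ θ`, `c_W = u²c_V − r` (the tree's
`SatisfiesSigmaODE.variableChange_subst`) run over `K` on a normalised odd square root `σ₁` of `Σ`
(`exists_sq_eq`), squared (`σ_W ∈ u⁻¹·ℚ_p⟦z⟧` is irrational, `σ_W²` is not), identified through
`1/x_V ∘ θ = u²/x_W` (`formalInvX_variableChange_subst`) and descended along the injection `ℚ_p → K`
(`satisfiesSigmaSqODE_map_iff`). So an ADDITIVE quadratic twist at `p` of a good ordinary curve carries a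
sigma-squared pair and the tree's squared theta relation (`IsMazurTateSigmaSqPair.thetaSq_formal`)
applies to it. [Mazur–Tate 1991, §3 (functoriality of `σ_{(E,ω)}`) and Thm. 3.1; Mazur–Stein–Tate 2006,
Thm. 1.3 and §1 (`c` has weight 2); Silverman 2005, §5 Rem. 2 (`σ²` at `p = 2`)]
[cite: MazurTate1991, Thm. 3.1] [cite: MazurSteinTate2006, Thm. 1.3] [cite: Silverman2005DivPoly, §5 Rem. 2] -/
theorem isMazurTateSigmaSqPair_twistTransport [V.IsIntegral ℤ_[p]] [W.IsIntegral ℤ_[p]]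
    (hvc : vc • W.map (algebraMap ℚ_[p] K) = V.map (algebraMap ℚ_[p] K)) (hr : vc.r = 0)
    {D : ℚ_[p]} (hu : ((vc.u : Kˣ) : K) ^ 2 = algebraMap ℚ_[p] K D) (hD : ‖D‖ ≤ 1)
    {Sq : ℚ_[p]⟦X⟧} {c : ℚ_[p]} (hpair : V.IsMazurTateSigmaSqPair Sq c)
    {S : ℚ_[p]⟦X⟧} (hS : V.IsInvXExpansion Sq S) :
    W.IsMazurTateSigmaSqPair (C D⁻¹ * S.subst (C D * W.formalInvX)) (D * c) := by
  set φ := algebraMap ℚ_[p] K with hφdef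
  have hφ : Function.Injective φ := φ.injective
  -- `D ≠ 0`, `D⁻¹D = 1`
  have hD0 : D ≠ 0 := by
    intro h0
    rw [h0, map_zero] at hu
    exact (vc.u).ne_zero (pow_eq_zero_iff two_ne_zero |>.mp hu)
  have hab : D⁻¹ * D = 1 := inv_mul_cancel₀ hD0
  -- normalisation of `S`
  have hS0 : constantCoeff S = 0 := hS.constantCoeff_eq hpair.constantCoeff_eq
  have hS1 : coeff 1 S = 1 := hS.coeff_one_eq hpair.constantCoeff_eq hpair.coeff_two_eq
  have h2 : coeff 2 (C D⁻¹ * S.subst (C D * W.formalInvX)) = 1 :=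
    W.coeff_two_rescale_subst_formalInvX S hS0 hS1 hab
  -- a normalised odd square root of `Σ`, over `K`
  obtain ⟨σ₁, h10, h11, hodd, hODE, hSq⟩ := hpair.exists_sq_eq
  have h10' : constantCoeff (PowerSeries.map φ σ₁) = 0 := by
    rw [← coeff_zero_eq_constantCoeff_apply, coeff_map, coeff_zero_eq_constantCoeff_apply, h10, map_zero]
  have h11' : coeff 1 (PowerSeries.map φ σ₁) = 1 := by rw [coeff_map, h11, map_one]
  have hodd' := Literature.NumberTheory.EllipticCurves.PadicSigmaSqTwo.MazurTate.isFormallyOdd_map_ringHom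
    φ hodd
  have hODE' := Literature.NumberTheory.EllipticCurves.PadicSigmaSqTwo.MazurTate.satisfiesSigmaODE_map_ringHom
    φ h10 h11 hODE
  rw [← hvc] at hodd' hODE'
  -- transport along `θ : Ŵ_K → V̂_K`
  set WK := W.map φ with hWK
  set θ := WK.formalVariableChange vc with hθdef
  have hθs := WK.hasSubst_formalVariableChange vc
  have hτodd := hodd'.variableChange_subst ((vc.u⁻¹ : Kˣ) : K)
  have hτODE := hODE'.variableChange_subst h10' h11'
  set τ : K⟦X⟧ := C ((vc.u⁻¹ : Kˣ) : K) * (PowerSeries.map φ σ₁).subst θ with hτdef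
  have hτ0 : constantCoeff τ = 0 := by
    rw [hτdef, map_mul, WK.constantCoeff_subst_formalVariableChange vc h10', mul_zero]
  have hτ1 : coeff 1 τ = 1 := by
    rw [hτdef, coeff_C_mul, WK.coeff_one_subst_formalVariableChange vc h11', Units.inv_mul]
  have hsqODE : WK.SatisfiesSigmaSqODE (τ ^ 2) ((vc.u : K) ^ 2 * φ c - vc.r) := hτODE.sq hτ0 hτ1
  -- `τ² = (D⁻¹·𝔖(D/x_W))^φ`
  have hgV : HasSubst (vc • WK).formalInvX := (vc • WK).hasSubst_formalInvX
  have key : τ ^ 2 = PowerSeries.map φ (C D⁻¹ * S.subst (C D * W.formalInvX)) := by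
    have hφD : φ D = ((vc.u : Kˣ) : K) ^ 2 := hu.symm
    have hφDi : φ D⁻¹ = ((vc.u⁻¹ : Kˣ) : K) ^ 2 := by
      rw [map_inv₀, hφD, Units.val_inv_eq_inv_val, inv_pow]
    rw [hτdef, mul_pow, ← map_pow, ← subst_pow hθs, ← map_pow, ← hSq,
      show Sq = S.subst V.formalInvX from hS.symm,
      Literature.NumberTheory.EllipticCurves.powerSeries_map_subst V.hasSubst_formalInvX φ S,
      map_formalInvX, ← hvc, subst_comp_subst_apply hgV hθs, WK.formalInvX_variableChange_subst vc hr,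
      map_mul, PowerSeries.map_C,
      Literature.NumberTheory.EllipticCurves.powerSeries_map_subst
        (HasSubst.of_constantCoeff_zero' (by rw [map_mul, constantCoeff_formalInvX, mul_zero])) φ S,
      map_mul, PowerSeries.map_C, map_formalInvX, hφD, hφDi]
  -- descend the sigma-squared equation
  have hconst : (vc.u : K) ^ 2 * φ c - vc.r = φ (D * c) := by rw [hr, sub_zero, map_mul, hu]
  rw [key, hconst] at hsqODE
  have hode : W.SatisfiesSigmaSqODE (C D⁻¹ * S.subst (C D * W.formalInvX)) (D * c) :=
    (W.satisfiesSigmaSqODE_map_iff φ hφ h2).mp hsqODE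
  exact
    { constantCoeff_eq := W.constantCoeff_rescale_subst_formalInvX S hS0 hab
      coeff_one_eq := W.coeff_one_rescale_subst_formalInvX S hS0 hab
      coeff_two_eq := h2
      norm_coeff_le := isPadicInt_iff_coeff.mp
        (isPadicInt_rescale_subst_formalInvX (hS.isPadicInt hpair.isPadicInt) hS0 hab hD)
      even := isFormallyEven_rescale_subst_formalInvX S _ _
      ode := hode }

end Transport

end WeierstrassCurve
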